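import Summits.QuantumFields.BalabanUV.Beta.D1BFx.RestKernelSandwichLoc
import Summits.QuantumFields.BalabanUV.Beta.RecursiveWSlot
import Summits.QuantumFields.BalabanUV.Beta.SymmetrisedStepJets

/-!
# Road «BF-x» — (J1) RESIDUE S7 v0.2, PART (L2-S): THE PER-SLOT-PAIR SUPPORT ROWS `hBs` OF THE RAW (III′) LITERAL's LEVEL-0 PAIR TABLE, AND THE WILSON
# PAIR SECTOR's k-FREE MASS ROW `hBm` — UNCONDITIONAL
# (unit `b2b-balaban-beta-d1-formalise-leaf-01`, gen 27 — head lineage of the (L1)(L2) packaging; row D1 RULING R-D1-g43-1 (M-b) «`hSs` per slot … and `S₂⁰`'s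
# `vh₂S` rows in PACKED-VERTEX form» + (iii) «`S₂⁰` OF RECORD at the α-pin := the literal's RAW level-0 pair table `T2RecOf … 0 = n⁸ • wilsonW₂ + cB • tabs.vh₂S`»)

HONEST DEPENDENCY (page 1, mandatory): continuum YM on T⁴ ⇐ BetaPertH ∧ nine spine estimates (0/9 proved); BetaPertH ⇐ (D1) ∧ (D4) ∧ CAP+tail;
G-an2-4 gates asym, D1 and NE2/3/4.  HONEST FRAMING (cell contract, verbatim): «discharging `BetaPertH` makes Bałaban's UV stability UNCONDITIONAL — a real
constructive-QFT result; it is NOT the continuum limit and NOT the Clay problem.»  THIS FILE: [folklore] localisation bookkeeping over OUR typed objects, NO hypothesis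
of Bałaban's, NO displayed decay binder (the level-0 pair table is resolvent-free); it discharges NO row of the wall by itself.  0 root-level binders of row D1
discharged (hW ∕ hR-sockets ∕ hSX-socket ∕ D1Tel ∕ D1Rep); NOT D1, NOT BetaPertH, NOT continuum, NOT Clay.

WHAT IT SAYS (companion of `D1BFx/RawStencilSupportRows` (L1-S)).
* §1 (generic) `plainMass_blk_le_of_biLoc`: a kernel `BiLoc K u u C δ` (`0 ≤ C`, `0 < δ`) has, block by block, a SUMMABLE plain mass `Σ'_{(p,q)} Σ_{g f} |blk K j i p q g f|`
  bounded by `16·C·Zl 4 (δ∕2)²` (`RestKernelSandwichLoc.mass_le_of_biLoc` at weight rate `0` + `PackedKernelSplit.biLoc_blk`).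
* §2 THE LEVEL-0 PAIR TABLE `W⁰₂ := fun κ u κ′ u′ => cE₂ • wilsonW₂ 3 T κ u κ′ u′ + cB • V₂ κ u κ′ u′` for ANY Wilson coupling table `T`, ANY second-order border table
  `V₂` with its record letter `(LB) ∃ C δ, 0 < δ ∧ LocStencil₂ V₂ C δ` (the field `SymTables.hB`), any numerals `cE₂ cB`: every member is bi-localised at its first slot
  (`biLoc_pair_zero`), so **`hBs_pair_zero`**: `∀ κ u κ′ u′ j i, Summable (p ↦ Σ_{g f} |blk (W⁰₂ κ u κ′ u′) j i p.1 p.2 g f|)` — the END's (L2) support row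
  (`PackedRoadRowsMass.table_letters_mass`'s `hBs`) AT ONE BLOCKING, UNCONDITIONALLY; `hBs_T2RecOf_zero` restates it for `SpineRooted.T2RecOf G S M cE₂ cB T V₂ mixFF 0`
  (`T2RecOf_zero_level`, `rfl`) and `hBs_pair_zero_tabs` at a record `tabs : SymTables 3 n` (`V₂ := tabs.vh₂S`, letter `tabs.hB`).
* §3 ACROSS THE SCALES in the END's binder shape: **`hBs_pair_scales`** for families `T k`, `tabs k : SymTables 3 (Lc^k)`, `cE₂ cB : ℕ → ℝ` — `∀ k ≥ 1, ∀ κ u κ′ u′ j i, Summable …`.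
* §4 (M-c)-type located fact for the PAIR unit `cE₂ = n⁸`: **`plainMass_blk_wilsonW₂_le`** — the Wilson pair sector ALONE has a k-FREE plain block mass with the two-slot
  decay the END's `hBm` asks: `Σ' … |blk (wilsonW₂ 3 T κ u κ′ u′) j i …| ≤ (16·wBound₂ 3 T·e⁸·Zl 4 (1∕2)²)·e^{−1·|u′−u|₁} ≤ (same)·e^{−(δ₂₀∕n)|u′−u|₁}` whenever
  `δ₂₀∕n ≤ 1` (`hBm_wilsonW₂`); the border pair sector `cB • vh₂S` (`cB = −n¹²∕4` at the lock) has NO such per-slot-pair k-free row claimed here — by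
  R-D1-g43-1 (M-b) its mass rows go in PACKED form.
ABSOLUTE RULE (cell charter, verbatim): «No internally-minted statement may enter as a cited fact. Every hypothesis is either kernel-proved in this package or a
verbatim quotation of a PUBLISHED theorem with page reference. The manuscript(s) under audit are NOT citable for their own disputed steps — they are the thing
under adjudication; programme-internal (2001/route/tribunal) claims are never citable.»  No `def`, no `def … : Prop`, nothing cited as mathematics; 0 sorry.
-/

noncomputable section

open Finset
open scoped BigOperators
open Literature.MathematicalPhysics.QuantumFieldTheory
open Literature.MathematicalPhysics.QuantumFieldTheory.Balaban1983to89
open Literature.MathematicalPhysics.QuantumFieldTheory.Balaban1983to89.Beta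
open B12Sec2to5 (l1 l1_nonneg)
open ExpKernelCalculus (Site MKer BiLoc Zl Zl_nonneg)
open KernelWard (biLoc_add)
open StepJetData (biLoc_smul)
open OneStepResolventKernel (Fib)
open BalabanCompositeJets (LocStencil₂)
open WilsonBiStencil (wilsonW₂ wBound₂ wBound₂_nonneg biLoc_wilsonW₂)
open Summit.QuantumFields.BalabanUV.Beta.SymmetrisedStepJets (SymTables)
open Summit.QuantumFields.BalabanUV.Beta.SpineRooted (T2RecOf T2RecOf_zero_level)
open Summit.QuantumFields.BalabanUV.Beta.D1BFx.PackedKernelSplit (blk biLoc_blk)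
open Summit.QuantumFields.BalabanUV.Beta.D1BFx.RestKernelSandwichLoc (mass_le_of_biLoc)

namespace Summit.QuantumFields.BalabanUV.Beta.D1BFx.RawPairStencilSupportRows

/-! ## §1 Generic: plain block mass of a bi-localised kernel -/

/-- [folklore] **PLAIN BLOCK MASS OF A BI-LOCALISED KERNEL**: `BiLoc K u u C δ`, `0 ≤ C`, `0 < δ` ⊢ for every block `(j,i)` the plain mass
`Σ'_{(p,q)} Σ_{g f} |blk K j i p q g f|` is summable and `≤ 16·C·Zl 4 (δ∕2)²` (weight rate `0` in `mass_le_of_biLoc`). -/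
theorem plainMass_blk_le_of_biLoc {K : MKer 4 (Fib 3)} {u : Fin 4 → ℤ} {C δ : ℝ} (hK : BiLoc K u u C δ) (hC : 0 ≤ C) (hδ : 0 < δ) (j i : Bool) :
    (Summable fun p : Site 4 × Site 4 => ∑ g, ∑ f, |blk K j i p.1 p.2 g f|) ∧
      ∑' p : Site 4 × Site 4, ∑ g, ∑ f, |blk K j i p.1 p.2 g f| ≤ 16 * C * Zl 4 (δ / 2) ^ 2 := by
  have h := mass_le_of_biLoc (σ := 0) (biLoc_blk hK j i) hC hδ (by positivity)
  have h16 : (Fintype.card (Fin 4) : ℝ) ^ 2 = 16 := by norm_num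
  simp only [zero_mul, Real.exp_zero, mul_one, h16] at h
  exact h

/-! ## §2 The level-0 pair table: every member bi-localised at its first slot; the support row `hBs`, unconditionally -/

section Pair

variable {n : ℕ}

/-- [folklore] **EVERY MEMBER OF THE LEVEL-0 PAIR TABLE IS BI-LOCALISED AT ITS FIRST SLOT, AT A POSITIVE RATE** (Wilson pair sector: `biLoc_wilsonW₂` at
the border table's rate; border pair sector: its record letter (LB)): for `W⁰₂ κ u κ′ u′ = cE₂ • wilsonW₂ 3 T κ u κ′ u′ + cB • V₂ κ u κ′ u′`. -/
theorem biLoc_pair_zero (T : Fin 4 → Fin 4 → Fin 4 → Fin 4 → ℝ) {V₂ : Fin 4 → (Fin 4 → ℤ) → Fin 4 → (Fin 4 → ℤ) → MKer 4 (Fib 3)}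
    (hV₂ : ∃ C δ : ℝ, 0 < δ ∧ LocStencil₂ V₂ C δ) (cE₂ cB : ℝ) (κ : Fin 4) (u : Fin 4 → ℤ) (κ' : Fin 4) (u' : Fin 4 → ℤ) :
    ∃ C δ : ℝ, 0 ≤ C ∧ 0 < δ ∧ BiLoc (cE₂ • wilsonW₂ 3 T κ u κ' u' + cB • V₂ κ u κ' u') u u C δ := by
  obtain ⟨C₂, δ, hδ, hB⟩ := hV₂
  have h1 : BiLoc (wilsonW₂ 3 T κ u κ' u') u u (wBound₂ 3 T * Real.exp (8 * δ) * Real.exp (-δ * l1 (u' - u))) δ :=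
    biLoc_wilsonW₂ T hδ.le κ u κ' u'
  have h2 : BiLoc (V₂ κ u κ' u') u u (C₂ * Real.exp (-δ * l1 (u' - u))) δ := hB κ u κ' u'
  have h := biLoc_add (biLoc_smul h1 cE₂) (biLoc_smul h2 cB)
  exact ⟨_, δ, h.nonneg (Sum.inl 0), hδ, h⟩

/-- [folklore] **`hBs` FOR THE LEVEL-0 PAIR TABLE, UNCONDITIONALLY** (any coupling table `T`, any border pair table with its (LB) letter, any numerals): every
slot pair's plain block mass is summable. -/
theorem hBs_pair_zero (T : Fin 4 → Fin 4 → Fin 4 → Fin 4 → ℝ) {V₂ : Fin 4 → (Fin 4 → ℤ) → Fin 4 → (Fin 4 → ℤ) → MKer 4 (Fib 3)}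
    (hV₂ : ∃ C δ : ℝ, 0 < δ ∧ LocStencil₂ V₂ C δ) (cE₂ cB : ℝ) (κ : Fin 4) (u : Fin 4 → ℤ) (κ' : Fin 4) (u' : Fin 4 → ℤ) (j i : Bool) :
    Summable fun p : Site 4 × Site 4 =>
      ∑ g, ∑ f, |blk ((fun κ u κ' u' => cE₂ • wilsonW₂ 3 T κ u κ' u' + cB • V₂ κ u κ' u') κ u κ' u') j i p.1 p.2 g f| := by
  obtain ⟨C, δ, hC, hδ, h⟩ := biLoc_pair_zero T hV₂ cE₂ cB κ u κ' u'
  exact (plainMass_blk_le_of_biLoc h hC hδ j i).1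

/-- [folklore] **`hBs` FOR `T2RecOf … 0`** (the record's level-0 pair table, `T2RecOf_zero_level`; `G S M mixFF` idle at level `0`). -/
theorem hBs_T2RecOf_zero {Lc : ℕ} (G : ℕ → MKer 4 (Fib 3)) (S M : ℕ → Fin 4 → (Fin 4 → ℤ) → MKer 4 (Fib 3)) (cE₂ cB : ℝ)
    (T : Fin 4 → Fin 4 → Fin 4 → Fin 4 → ℝ) {V₂ : Fin 4 → (Fin 4 → ℤ) → Fin 4 → (Fin 4 → ℤ) → MKer 4 (Fib 3)}
    (mixFF : Fin 4 → (Fin 4 → ℤ) → Fin 4 → (Fin 4 → ℤ) → MKer 4 (Fib 3)) (hV₂ : ∃ C δ : ℝ, 0 < δ ∧ LocStencil₂ V₂ C δ)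
    (κ : Fin 4) (u : Fin 4 → ℤ) (κ' : Fin 4) (u' : Fin 4 → ℤ) (j i : Bool) :
    Summable fun p : Site 4 × Site 4 =>
      ∑ g, ∑ f, |blk (T2RecOf 3 Lc G S M cE₂ cB T V₂ mixFF 0 κ u κ' u') j i p.1 p.2 g f| := by
  rw [T2RecOf_zero_level]
  exact hBs_pair_zero T hV₂ cE₂ cB κ u κ' u' j i

/-- [folklore] **`hBs` AT A TABLE RECORD** `tabs : SymTables 3 n` (`V₂ := tabs.vh₂S`, letter `tabs.hB`). -/
theorem hBs_pair_zero_tabs (tabs : SymTables 3 n) (T : Fin 4 → Fin 4 → Fin 4 → Fin 4 → ℝ) (cE₂ cB : ℝ)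
    (κ : Fin 4) (u : Fin 4 → ℤ) (κ' : Fin 4) (u' : Fin 4 → ℤ) (j i : Bool) :
    Summable fun p : Site 4 × Site 4 =>
      ∑ g, ∑ f, |blk ((fun κ u κ' u' => cE₂ • wilsonW₂ 3 T κ u κ' u' + cB • tabs.vh₂S κ u κ' u') κ u κ' u') j i p.1 p.2 g f| :=
  hBs_pair_zero T tabs.hB cE₂ cB κ u κ' u' j i

end Pair

/-! ## §3 Across the scales `n = Lc^k`, in the END's binder shape -/

section Scales

variable {Lc : ℕ}

/-- [folklore] **`hBs` FOR THE RAW LEVEL-0 PAIR TABLES ACROSS THE SCALES** (`PackedRoadRowsMass.table_letters_mass`'s binder shape at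
`S₂ (Lc^k) := fun κ u κ′ u′ => cE₂ k • wilsonW₂ 3 (T k) κ u κ′ u′ + cB k • (tabs k).vh₂S κ u κ′ u′`), UNCONDITIONALLY. -/
theorem hBs_pair_scales (tabs : ∀ k : ℕ, SymTables 3 (Lc ^ k)) (T : ℕ → Fin 4 → Fin 4 → Fin 4 → Fin 4 → ℝ) (cE₂ cB : ℕ → ℝ) :
    ∀ (k : ℕ), 1 ≤ k → ∀ (κ : Fin 4) (u : Fin 4 → ℤ) (κ' : Fin 4) (u' : Fin 4 → ℤ) (j i : Bool), Summable fun p : Site 4 × Site 4 =>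
      ∑ g, ∑ f, |blk ((fun κ u κ' u' => cE₂ k • wilsonW₂ 3 (T k) κ u κ' u' + cB k • (tabs k).vh₂S κ u κ' u') κ u κ' u') j i p.1 p.2 g f| :=
  fun k _ κ u κ' u' j i => hBs_pair_zero_tabs (tabs k) (T k) (cE₂ k) (cB k) κ u κ' u' j i

end Scales

/-! ## §4 The Wilson pair sector: k-free plain block mass with the two-slot decay of `hBm` -/

section Wilson

/-- [folklore] **THE WILSON PAIR SECTOR's PLAIN BLOCK MASS IS k-FREE WITH TWO-SLOT DECAY AT THE n-FREE RATE `1`**: for every slot pair and block,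
`Σ' … |blk (wilsonW₂ 3 T κ u κ′ u′) j i …| ≤ 16·(wBound₂ 3 T·e⁸·e^{−|u′−u|₁})·Zl 4 (1∕2)²` (`biLoc_wilsonW₂` at rate `1`). -/
theorem plainMass_blk_wilsonW₂_le (T : Fin 4 → Fin 4 → Fin 4 → Fin 4 → ℝ) (κ : Fin 4) (u : Fin 4 → ℤ) (κ' : Fin 4) (u' : Fin 4 → ℤ) (j i : Bool) :
    (Summable fun p : Site 4 × Site 4 => ∑ g, ∑ f, |blk (wilsonW₂ 3 T κ u κ' u') j i p.1 p.2 g f|) ∧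
      ∑' p : Site 4 × Site 4, ∑ g, ∑ f, |blk (wilsonW₂ 3 T κ u κ' u') j i p.1 p.2 g f|
        ≤ 16 * (wBound₂ 3 T * Real.exp (8 * 1) * Real.exp (-1 * l1 (u' - u))) * Zl 4 (1 / 2) ^ 2 := by
  have h1 : BiLoc (wilsonW₂ 3 T κ u κ' u') u u (wBound₂ 3 T * Real.exp (8 * 1) * Real.exp (-1 * l1 (u' - u))) 1 :=
    biLoc_wilsonW₂ T zero_le_one κ u κ' u'
  exact plainMass_blk_le_of_biLoc h1 (by have := wBound₂_nonneg 3 (T := T); positivity) one_pos j i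

/-- [folklore] **`hBm` FOR THE WILSON PAIR SECTOR, k-FREE** (the END's two-slot decay shape at rate `δ₂₀∕n` whenever `δ₂₀∕n ≤ 1`):
`Σ' … |blk (wilsonW₂ 3 T κ u κ′ u′) j i …| ≤ (16·wBound₂ 3 T·e⁸·Zl 4 (1∕2)²) · e^{−(δ₂₀∕n)·|u′−u|₁}`. -/
theorem hBm_wilsonW₂ (T : Fin 4 → Fin 4 → Fin 4 → Fin 4 → ℝ) {δ₂₀ : ℝ} {n : ℕ} (hδ : δ₂₀ / (n : ℝ) ≤ 1)
    (κ : Fin 4) (u : Fin 4 → ℤ) (κ' : Fin 4) (u' : Fin 4 → ℤ) (j i : Bool) :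
    ∑' p : Site 4 × Site 4, ∑ g, ∑ f, |blk (wilsonW₂ 3 T κ u κ' u') j i p.1 p.2 g f|
      ≤ (16 * (wBound₂ 3 T * Real.exp (8 * 1)) * Zl 4 (1 / 2) ^ 2) * Real.exp (-(δ₂₀ / (n : ℝ)) * l1 (u' - u)) := by
  have h := (plainMass_blk_wilsonW₂_le T κ u κ' u' j i).2
  have hl : 0 ≤ l1 (u' - u) := l1_nonneg _
  have hexp : Real.exp (-1 * l1 (u' - u)) ≤ Real.exp (-(δ₂₀ / (n : ℝ)) * l1 (u' - u)) :=
    Real.exp_le_exp.2 (by nlinarith)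
  have hK : 0 ≤ 16 * (wBound₂ 3 T * Real.exp (8 * 1)) * Zl 4 (1 / 2) ^ 2 := by
    have := wBound₂_nonneg 3 (T := T); have := Zl_nonneg (D := 4) (by norm_num : (0 : ℝ) < 1 / 2); positivity
  calc ∑' p : Site 4 × Site 4, ∑ g, ∑ f, |blk (wilsonW₂ 3 T κ u κ' u') j i p.1 p.2 g f|
      ≤ 16 * (wBound₂ 3 T * Real.exp (8 * 1) * Real.exp (-1 * l1 (u' - u))) * Zl 4 (1 / 2) ^ 2 := h
    _ = (16 * (wBound₂ 3 T * Real.exp (8 * 1)) * Zl 4 (1 / 2) ^ 2) * Real.exp (-1 * l1 (u' - u)) := by ring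
    _ ≤ (16 * (wBound₂ 3 T * Real.exp (8 * 1)) * Zl 4 (1 / 2) ^ 2) * Real.exp (-(δ₂₀ / (n : ℝ)) * l1 (u' - u)) :=
        mul_le_mul_of_nonneg_left hexp hK

end Wilson

end Summit.QuantumFields.BalabanUV.Beta.D1BFx.RawPairStencilSupportRows

end
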